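import Literature.AnabelianGeometry.SemiGraphs.AmbientVocabOfReal

/-!
# Dictionary between the container's §1 combinatorics at `SemiAnbdVocab.ofReal` and t1's `SemiGraph` ([SemiAnbd] §1 pp.11–14)

Mochizuki, *Semi-graphs of anabelioids*, Publ. RIMS **42** (2006), §1 pp.11–14 (verticial
cardinality, closed / open / isolated edges, locally finite, untangled semi-graphs, immersions,
excisions) (kurims `paper:url-f33ace170ff4`). [cite: MochizukiSemiAnbd2006, §1, p. 11]

PROOF-ONLY `_iff` bridges (L3 merge, ruling abc-iut-L3-lead 2026-08-25T18:12Z: "`SemiAnbdVocab.ofReal`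
+ `_iff` lemmas vs t1's `SemiGraph`"): the §§4–5 container `SemiAnbdVocab` (`InterfaceVocab.lean`)
DEFINES the combinatorial notions of §1 from its data (`SemiAnbdVocab.vertCard`, `IsClosedEdge`,
`IsOpenEdge`, `IsIsolatedEdge`, `BrAt`, `mapBrAt`, `IsGraphImmersion`, `IsGraphExcision`,
`IsLocallyFinite`, `IsUntangled`); at the real term `SemiAnbdVocab.ofReal R` (`AmbientVocabOfReal.lean`)
each coincides with t1's notion on the underlying semi-graph (`SemiGraph.lean`):

* `ofReal_vertCard_eq` (`= SemiGraph.vertCard`), `ofReal_isClosedEdge_iff`, `ofReal_isOpenEdge_iff`,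
  `ofReal_isIsolatedEdge_iff`;
* `ofReal_brAtEquiv : BrAt G v ≃ Star v` intertwining `mapBrAt` and `SemiGraph.Hom.starMap`, whence
  `ofReal_isGraphImmersion_iff` (`↔ SemiGraph.IsImmersion`), `ofReal_isGraphExcision_iff`;
* `ofReal_isLocallyFinite_iff`, `ofReal_isUntangled_iff`.

Also a NON-VACUITY WITNESS for the referees' vacuity audits: the degenerate residual
`SgA.BridgeResidual.trivial` (tempered := finite étale, `Out(π̂₁(G_v))` := the trivial profinite group —
NOT the intended residual) and `nonempty_semiAnbdVocab : Nonempty (SemiAnbdVocab SgA)`: the §§4–5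
container has a model at the real vocabulary, so no §4–§5 statement is vacuously parametrised.

Not here (recorded): `IsConnected` vs `SemiGraph.IsConnected` (barycentric subdivision),
`IsFiniteTree` vs `SemiGraph.IsTree`, `IsGraphEmbedding` vs `SemiGraph.IsEmbedding`.
-/

namespace Literature.AnabelianGeometry.SemiGraphs

open CategoryTheory

universe v₁ u₁ u

namespace SemiAnbdVocab

open SgAQuot SgAQuot.SgA

variable (R : SgA.BridgeResidual.{v₁, u₁, u})

/-! ### Verticial cardinality; closed, open, isolated edges -/

/-- Every edge has finitely many (two) branches. [cite: MochizukiSemiAnbd2006, §1, p. 11] -/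
theorem finite_branchesOf (G : SgA.{v₁, u₁, u}) (e : G.toSgA.graph.Edge) :
    Finite (G.toSgA.graph.branchesOf e) :=
  Nat.finite_of_card_ne_zero (by rw [G.toSgA.graph.natCard_branchesOf e]; decide)

/-- The container's verticial cardinality at the real vocabulary is t1's `SemiGraph.vertCard`.
[cite: MochizukiSemiAnbd2006, §1, p. 11] -/
theorem ofReal_vertCard_eq (G : SgA.{v₁, u₁, u}) (e : G.toSgA.graph.Edge) :
    (SemiAnbdVocab.ofReal R).vertCard e = G.toSgA.graph.vertCard e := by
  change Nat.card {b : G.toSgA.graph.branchesOf e // (G.toSgA.graph.abuts b.1).isSome} =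
    Nat.card (G.toSgA.graph.verticialPortion e)
  exact Nat.card_congr
    { toFun := fun b => ⟨b.1.1, b.1.2, b.2⟩
      invFun := fun b => ⟨⟨b.1, b.2.1⟩, b.2.2⟩
      left_inv := fun _ => rfl
      right_inv := fun _ => rfl }

/-- The container's "closed edge" (all branches abut) at the real vocabulary is t1's (verticial
cardinality `2`). [cite: MochizukiSemiAnbd2006, §1, p. 12] -/
theorem ofReal_isClosedEdge_iff (G : SgA.{v₁, u₁, u}) (e : G.toSgA.graph.Edge) :
    (SemiAnbdVocab.ofReal R).IsClosedEdge e ↔ G.toSgA.graph.IsClosedEdge e := by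
  change (∀ b : G.toSgA.graph.branchesOf e, (G.toSgA.graph.abuts b.1).isSome) ↔
    G.toSgA.graph.vertCard e = 2
  rw [← ofReal_vertCard_eq R G e]
  change _ ↔ Nat.card {b : G.toSgA.graph.branchesOf e // (G.toSgA.graph.abuts b.1).isSome} = 2
  haveI := finite_branchesOf G e
  constructor
  · intro h
    rw [← G.toSgA.graph.natCard_branchesOf e]
    exact Nat.card_congr (Equiv.subtypeUnivEquiv h)
  · intro h b
    have hbij : Function.Bijective
        (fun x : {b : G.toSgA.graph.branchesOf e // (G.toSgA.graph.abuts b.1).isSome} => x.1) :=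
      Function.Injective.bijective_of_nat_card_le Subtype.val_injective
        (by rw [h, G.toSgA.graph.natCard_branchesOf e])
    obtain ⟨x, hx⟩ := hbij.2 b
    rw [← hx]
    exact x.2

/-- The container's "open edge" at the real vocabulary is t1's (verticial cardinality `< 2`).
[cite: MochizukiSemiAnbd2006, §1, p. 12] -/
theorem ofReal_isOpenEdge_iff (G : SgA.{v₁, u₁, u}) (e : G.toSgA.graph.Edge) :
    (SemiAnbdVocab.ofReal R).IsOpenEdge e ↔ G.toSgA.graph.IsOpenEdge e := by
  change ¬ (SemiAnbdVocab.ofReal R).IsClosedEdge e ↔ G.toSgA.graph.vertCard e < 2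
  rw [ofReal_isClosedEdge_iff]
  change ¬ G.toSgA.graph.vertCard e = 2 ↔ _
  have hle : G.toSgA.graph.vertCard e ≤ 2 := by
    rw [← ofReal_vertCard_eq R G e, ← G.toSgA.graph.natCard_branchesOf e]
    haveI := finite_branchesOf G e
    exact Nat.card_le_card_of_injective
      (fun x : {b : G.toSgA.graph.branchesOf e // (G.toSgA.graph.abuts b.1).isSome} => x.1)
      Subtype.val_injective
  omega

/-- The container's "isolated edge" (no branch abuts) at the real vocabulary is t1's (verticial
cardinality `0`). [cite: MochizukiSemiAnbd2006, §1, p. 12] -/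
theorem ofReal_isIsolatedEdge_iff (G : SgA.{v₁, u₁, u}) (e : G.toSgA.graph.Edge) :
    (SemiAnbdVocab.ofReal R).IsIsolatedEdge e ↔ G.toSgA.graph.IsIsolatedEdge e := by
  change (∀ b : G.toSgA.graph.branchesOf e, G.toSgA.graph.abuts b.1 = none) ↔
    G.toSgA.graph.vertCard e = 0
  rw [← ofReal_vertCard_eq R G e]
  change _ ↔ Nat.card {b : G.toSgA.graph.branchesOf e // (G.toSgA.graph.abuts b.1).isSome} = 0
  haveI := finite_branchesOf G e
  rw [Nat.card_eq_zero, or_iff_left (not_infinite_iff_finite.mpr inferInstance), isEmpty_subtype]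
  refine forall_congr' fun b => ?_
  rw [Option.not_isSome_iff_eq_none]

/-! ### Branches at a vertex; immersions and excisions -/

/-- The container's "branches abutting to `v`" at the real vocabulary is t1's `Star v`.
[cite: MochizukiSemiAnbd2006, §1, p. 13] -/
def ofReal_brAtEquiv (G : SgA.{v₁, u₁, u}) (v : G.toSgA.graph.Vertex) :
    (SemiAnbdVocab.ofReal R).BrAt G v ≃ G.toSgA.graph.Star v where
  toFun x := ⟨x.1.2.1, x.2⟩
  invFun b := ⟨⟨G.toSgA.graph.edgeOf b.1, ⟨b.1, rfl⟩⟩, b.2⟩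
  left_inv := by
    rintro ⟨⟨e, ⟨b, hb⟩⟩, h⟩
    subst hb
    rfl
  right_inv _ := rfl

/-- The equivalence intertwines the container's `mapBrAt` with t1's `starMap`.
[cite: MochizukiSemiAnbd2006, §1, p. 14] -/
theorem ofReal_brAtEquiv_mapBrAt {G H : SgA.{v₁, u₁, u}} (f : G ⟶ H) (v : G.toSgA.graph.Vertex)
    (x : (SemiAnbdVocab.ofReal R).BrAt G v) :
    ofReal_brAtEquiv R H _ ((SemiAnbdVocab.ofReal R).mapBrAt f v x) =
      SemiGraph.Hom.starMap f.hom.hom.base v (ofReal_brAtEquiv R G v x) :=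
  rfl

/-- **The container's "immersion" (Def 4.1 / §1 p.14) at the real vocabulary is t1's
`SemiGraph.IsImmersion`** of the underlying morphism of semi-graphs. [cite: MochizukiSemiAnbd2006, §1, p. 14] -/
theorem ofReal_isGraphImmersion_iff {G H : SgA.{v₁, u₁, u}} (f : G ⟶ H) :
    (SemiAnbdVocab.ofReal R).IsGraphImmersion f ↔ SemiGraph.IsImmersion f.hom.hom.base := by
  refine forall_congr' fun v => ?_
  have hsq : (ofReal_brAtEquiv R H _) ∘ (SemiAnbdVocab.ofReal R).mapBrAt f v =
      SemiGraph.Hom.starMap f.hom.hom.base v ∘ ofReal_brAtEquiv R G v :=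
    funext (ofReal_brAtEquiv_mapBrAt R f v)
  constructor
  · intro h
    have := ((ofReal_brAtEquiv R H _).injective.comp h)
    rw [hsq] at this
    exact this.of_comp_right (ofReal_brAtEquiv R G v).surjective
  · intro h
    have := h.comp (ofReal_brAtEquiv R G v).injective
    rw [← hsq] at this
    exact this.of_comp

/-- **The container's "excision" at the real vocabulary is t1's `SemiGraph.IsExcision`.**
[cite: MochizukiSemiAnbd2006, §1, p. 14] -/
theorem ofReal_isGraphExcision_iff {G H : SgA.{v₁, u₁, u}} (f : G ⟶ H) :
    (SemiAnbdVocab.ofReal R).IsGraphExcision f ↔ SemiGraph.IsExcision f.hom.hom.base := by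
  refine forall_congr' fun v => ?_
  have hsq : (ofReal_brAtEquiv R H _) ∘ (SemiAnbdVocab.ofReal R).mapBrAt f v =
      SemiGraph.Hom.starMap f.hom.hom.base v ∘ ofReal_brAtEquiv R G v :=
    funext (ofReal_brAtEquiv_mapBrAt R f v)
  constructor
  · intro h
    have := ((ofReal_brAtEquiv R H _).bijective.comp h)
    rw [hsq] at this
    exact (Function.Bijective.of_comp_iff _ (ofReal_brAtEquiv R G v).bijective).mp this
  · intro h
    have := h.comp (ofReal_brAtEquiv R G v).bijective
    rw [← hsq] at this
    exact (Function.Bijective.of_comp_iff' (ofReal_brAtEquiv R H _).bijective _).mp this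

/-! ### Locally finite and untangled semi-graphs -/

/-- **The container's "locally finite" (finitely many branches at each vertex) at the real
vocabulary is t1's `SemiGraph.IsLocallyFinite`** (finitely many edges abutting to each vertex; every
edge has two branches). [cite: MochizukiSemiAnbd2006, §1, p. 13] -/
theorem ofReal_isLocallyFinite_iff (G : SgA.{v₁, u₁, u}) :
    (SemiAnbdVocab.ofReal R).IsLocallyFinite G ↔ G.toSgA.graph.IsLocallyFinite := by
  rw [SemiGraph.isLocallyFinite_iff]
  refine forall_congr' fun v => ?_
  rw [Equiv.finite_iff (ofReal_brAtEquiv R G v)]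
  constructor
  · intro h
    have hsub : {e : G.toSgA.graph.Edge | G.toSgA.graph.EdgeAbuts e v} =
        Set.range (fun b : G.toSgA.graph.Star v => G.toSgA.graph.edgeOf b.1) := by
      ext e
      constructor
      · rintro ⟨b, hbe, hbv⟩
        exact ⟨⟨b, hbv⟩, hbe⟩
      · rintro ⟨⟨b, hbv⟩, rfl⟩
        exact ⟨b, rfl, hbv⟩
    rw [hsub]
    exact Set.finite_range _
  · intro h
    haveI : Finite {e : G.toSgA.graph.Edge | G.toSgA.graph.EdgeAbuts e v} := h
    haveI : ∀ e : {e : G.toSgA.graph.Edge | G.toSgA.graph.EdgeAbuts e v},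
        Finite (G.toSgA.graph.branchesOf e.1) := fun e => finite_branchesOf G e.1
    refine Finite.of_injective
      (fun b : G.toSgA.graph.Star v =>
        (⟨⟨G.toSgA.graph.edgeOf b.1, b.1, rfl, b.2⟩, ⟨b.1, rfl⟩⟩ :
          Σ e : {e : G.toSgA.graph.Edge | G.toSgA.graph.EdgeAbuts e v},
            G.toSgA.graph.branchesOf e.1)) ?_
    rintro ⟨b₁, h₁⟩ ⟨b₂, h₂⟩ h
    have := congrArg (fun p : Σ e : {e : G.toSgA.graph.Edge | G.toSgA.graph.EdgeAbuts e v},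
      G.toSgA.graph.branchesOf e.1 => p.2.1) h
    exact Subtype.ext this

/-- **The container's "untangled" (the branches of a closed edge have distinct abutments) at the
real vocabulary is t1's `SemiGraph.IsUntangled`** (every closed edge joins two distinct vertices).
[cite: MochizukiSemiAnbd2006, §1, p. 13] -/
theorem ofReal_isUntangled_iff (G : SgA.{v₁, u₁, u}) :
    (SemiAnbdVocab.ofReal R).IsUntangled G ↔ G.toSgA.graph.IsUntangled := by
  rw [SemiGraph.isUntangled_iff]
  refine forall_congr' fun e => ?_
  rw [← ofReal_isClosedEdge_iff R G e]
  change ((SemiAnbdVocab.ofReal R).IsClosedEdge e →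
      ∀ b₁ b₂ : G.toSgA.graph.branchesOf e, b₁ ≠ b₂ →
        G.toSgA.graph.abuts b₁.1 ≠ G.toSgA.graph.abuts b₂.1) ↔
    ((SemiAnbdVocab.ofReal R).IsClosedEdge e →
      ∃ v₁ v₂, v₁ ≠ v₂ ∧ G.toSgA.graph.Joins e v₁ v₂)
  refine imp_congr_right fun hcl => ?_
  have hcl' : ∀ b : G.toSgA.graph.branchesOf e, (G.toSgA.graph.abuts b.1).isSome := hcl
  obtain ⟨b₁, b₂, hne, h₁, h₂, hall⟩ := G.toSgA.graph.two_branches e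
  obtain ⟨v₁, hv₁⟩ := Option.isSome_iff_exists.mp (hcl' ⟨b₁, h₁⟩)
  obtain ⟨v₂, hv₂⟩ := Option.isSome_iff_exists.mp (hcl' ⟨b₂, h₂⟩)
  constructor
  · intro h
    refine ⟨v₁, v₂, ?_, b₁, b₂, hne, h₁, h₂, hv₁, hv₂⟩
    intro hv
    apply h ⟨b₁, h₁⟩ ⟨b₂, h₂⟩ (fun heq => hne (congrArg Subtype.val heq))
    change G.toSgA.graph.abuts b₁ = G.toSgA.graph.abuts b₂
    rw [hv₁, hv₂, hv]
  · rintro ⟨w₁, w₂, hw, c₁, c₂, hcne, hc₁, hc₂, hw₁, hw₂⟩ x y hxy habut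
    -- `x`, `y` are the two branches `c₁`, `c₂` in some order
    have hx := hall x.1 x.2
    have hy := hall y.1 y.2
    have hc₁' := hall c₁ hc₁
    have hc₂' := hall c₂ hc₂
    have key : G.toSgA.graph.abuts b₁ = G.toSgA.graph.abuts b₂ := by
      rcases hx with hx | hx <;> rcases hy with hy | hy
      · exact absurd (Subtype.ext (hx.trans hy.symm)) hxy
      · change G.toSgA.graph.abuts x.1 = G.toSgA.graph.abuts y.1 at habut
        rw [hx, hy] at habut; exact habut
      · change G.toSgA.graph.abuts x.1 = G.toSgA.graph.abuts y.1 at habut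
        rw [hx, hy] at habut; exact habut.symm
      · exact absurd (Subtype.ext (hx.trans hy.symm)) hxy
    apply hw
    rcases hc₁' with h1 | h1 <;> rcases hc₂' with h2 | h2
    · exact absurd (h1.trans h2.symm) hcne
    · rw [h1] at hw₁; rw [h2] at hw₂
      have := hw₁.symm.trans (key.trans hw₂)
      exact Option.some_injective _ this
    · rw [h1] at hw₁; rw [h2] at hw₂
      have := hw₁.symm.trans (key.symm.trans hw₂)
      exact Option.some_injective _ this
    · exact absurd (h1.trans h2.symm) hcne

end SemiAnbdVocab

/-! ### Non-vacuity: the container has a model at the real vocabulary -/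

namespace SgAQuot.SgA

/-- A DEGENERATE inhabitant of the bridge residual — tempered arrows := finite étale arrows (finite
étale coverings are tempered, Def 3.5 (ii); both residual laws then hold trivially) and
`Out(π̂₁(G_v))` := the trivial profinite group with the trivial outer representation.  This is NOT
the intended residual (Def 3.5 (ii) / Def 5.1 (i)(c)); it is a non-vacuity witness only.
[cite: MochizukiSemiAnbd2006, Def 3.5 (ii), p. 37] -/
noncomputable def BridgeResidual.trivial : BridgeResidual.{v₁, u₁, u} where
  IsTempered f := finiteEtale f.hom.hom
  isTempered_of_finiteEtale _ h := h
  locallyFiniteEtale_of_isTempered _ h := locallyFiniteEtale_of_finiteEtale h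
  OutVert _ _ := ProfiniteGrp.of PUnit.{u + 1}
  outRep _ _ _ := 1

end SgAQuot.SgA

/-- **Non-vacuity of the §§4–5 container at the real vocabulary**: `SemiAnbdVocab SgA` is inhabited
(by `SemiAnbdVocab.ofReal` at the degenerate residual), so the §4–§5 statements typed over
`(𝓥 : SemiAnbdVocab Obj)` are not parametrised over an empty type. [cite: MochizukiSemiAnbd2006, Rmk 2.4.2, p. 26] -/
theorem SemiAnbdVocab.nonempty_ofReal :
    Nonempty (SemiAnbdVocab.{max (u + 1) (u₁ + 1) (v₁ + 1), max u (u₁ + 1) (v₁ + 1), u}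
      SgAQuot.SgA.{v₁, u₁, u}) :=
  ⟨SemiAnbdVocab.ofReal SgAQuot.SgA.BridgeResidual.trivial.{v₁, u₁, u}⟩

end Literature.AnabelianGeometry.SemiGraphs
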